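import Summits.CriticalPhenomena.PercolationContinuityZ3.Theses.PercNearOneGluing
import Literature.Probability.Percolation.PercolationProofs
import Literature.Probability.Percolation.ConditionalPositiveAssociationProofs
import Literature.Probability.Percolation.TwoClusterConditionalAssociationProofs
import Summits.CriticalPhenomena.PercolationContinuityZ3.Theorems.PercNearOneGluingAdditiveGluingGoodTwoRelays
import HarnessLib

/-! TTRL-lite variant V162 of stmt-CriticalPhenomena-4576

Variant `card_le:A≤3` of the inductive step `stub_goodStep` of crux `PercNearOneGluing.AdditiveGluing`:
Kozma–Nitzan's good-quadruple inequality (linear selection form) for `(w, A, o, b)` with `b ∈ A`,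
`o ∉ A`, under the extra hypothesis `A.card ≤ 3`, given a positive-weight neighbour of `o` outside
`A` and the induction hypothesis on the number of positive-degree vertices.  For `A.card ≤ 3` the
conclusion holds outright (two relays besides the target): this is the landed theorem
`stub_goodStepTwoRelays_k41` (file `…AdditiveGluingGoodTwoRelays.lean`), so neither the neighbour
hypothesis nor the induction hypothesis is used.
-/

namespace Summit.CriticalPhenomena.PercolationContinuityZ3.Theorems

open MeasureTheory Literature.Probability.LatticeModels Literature.Probability.Percolation
open scoped Classical BigOperators

/-- TTRL-lite variant V162 (`card_le:A≤3`) of `stub_goodStep` (stmt-CriticalPhenomena-4576): the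
good-quadruple inequality `μ(o ↔ A, o ↮ b) + Σ_{W dead} μ(C(o) = W)·μ({sel W ↔ b in Wᶜ}ᶜ) ≤ t` for
`b ∈ A ∌ o`, `A.card ≤ 3`, every level `t` with `1 − t ≤ μ(a ↔ b)` on `A` and every selection
`sel W ∈ A`; the neighbour and induction hypotheses of the step are not needed at this size
(`stub_goodStepTwoRelays_k41`). [cite: KozmaNitzan2024, §3.2 (p. 12), Lemma 3 (pp. 6–7)] -/
theorem stub_goodStep_var162 : ∀ (n : ℕ) (w : Sym2 (Fin n) → unitInterval) (A : Finset (Fin n)) (o b : Fin n), A.card ≤ 3 → b ∈ A → o ∉ A → (∃ y : Fin n, y ∉ A ∧ y ≠ o ∧ (w s(o, y) : ℝ) ≠ 0) → (∀ w' : Sym2 (Fin n) → unitInterval, (Finset.univ.filter (fun v : Fin n => ∃ u : Fin n, 0 < (w' s(u, v) : ℝ))).card < (Finset.univ.filter (fun v : Fin n => ∃ u : Fin n, 0 < (w s(u, v) : ℝ))).card → ∀ (A' : Finset (Fin n)) (o' b' : Fin n), b' ∈ A' → o' ∉ A' → ∀ (t : ℝ) (sel : Finset (Fin n) → Fin n),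 (∀ W, sel W ∈ A') → (∀ a ∈ A', 1 - t ≤ (prodBernoulli w').real (openConn a b')) → (prodBernoulli w').real ((⋃ a ∈ A', openConn o' a) ∩ (openConn o' b')ᶜ) + ∑ W ∈ (Finset.univ : Finset (Finset (Fin n))).filter (fun W => o' ∈ W ∧ Disjoint W A'), (prodBernoulli w').real {ω : BondConfig (Fin n) | openCluster ω o' = (W : Set (Fin n))} * (prodBernoulli w').real (openConnIn ((W : Set (Fin n))ᶜ) (sel W) b')ᶜ ≤ t) → ∀ (t : ℝ) (sel : Finset (Fin n) → Fin n), (∀ W, sel W ∈ A) → (∀ a ∈ A, 1 - t ≤ (prodBernoulli w).real (openConn a b)) → (prodBernoulli w).real ((⋃ a ∈ A, openConn o a) ∩ (openConn o b)ᶜ) + ∑ W ∈ (Finset.univ : Finset (Finset (Fin n))).filter (fun W => o ∈ W ∧ Disjoint W A), (prodBernoulli w).real {ω : BondConfig (Fin n) | openCluster ω o = (W : Set (Fin n))} * (prodBernoulli w).real (openConnIn ((W : Set (Fin n))ᶜ) (sel W) b)ᶜ ≤ t := by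
  intro n w A o b hA3 hbA hoA _ _ t sel hsel hlev
  exact stub_goodStepTwoRelays_k41 n w A o b hbA hoA hA3 t sel hsel hlev

end Summit.CriticalPhenomena.PercolationContinuityZ3.Theorems
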